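import Summits.QuantumFields.YangMills.Theorems.BalabanLadderIRLightCodeFrame
import Summits.QuantumFields.YangMills.Theorems.PencilRigidityWeakCouplingHypercubicLimitStubTraceHolder
import HarnessLib

/-!
# Route `BalabanLadder`, crux `IR` (stmt-QuantumFields-19354): flux-code blindness — the `q`-level trace clustering

The attack lemma of the crux-idea card `Cruxes/IR/Ideas/ym19354-5-flux-code-blindness.md` (seat `ym-cruxidea-19354-5`
gen 3; `Sketch-g3.lean` rev 3 sha16 `c463f541daed4b01`, evidence #48 on stmt-QuantumFields-19354), landed per route-owner
ruling R34 (ym-beyond-p2 g25) `--supports stmt-QuantumFields-19354`: the `q`-level twin `stub_codeTraceCluster` of the landed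
`stub_traceCluster` (`Theorems/PencilRigidityWeakCouplingHypercubicLimitStubTraceCluster.lean`).

Derivation (card §Lever).  Split `E = L ⊕ W`, `L = span e` (invariant under the positive transfer operator `T`),
`‖T|_W‖ ≤ ρ`, `tr_W T^m = secExcess ≥ 0` (the residual `R_m` of `BalabanLadderIRLightCodeFrame`).  Then
`tr(T^a A T^b B) = LL + LW + WL + WW` with `|LW| ≤ (q+1)‖A‖‖B‖ρ^b`, `|WL| ≤ (q+1)‖A‖‖B‖ρ^a`, `|WW| ≤ ‖A‖‖B‖ρ^b X_a`
(trace Hölder, landed `stub_traceHolder`); the CODE condition makes `LL = αβ Σ_k θ_k^{a+b+2w} + O((q+1)(|α|+|β|)εc + (q+1)²εc²)`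
and `tr(T^p A) = α Σ_k θ_k^{p+w} + O((q+1)εc + ‖A‖X_p)` with `a+b+2w = p+w = N`; the main terms cancel in the connected
combination to `αβ Θ_N X_W(N)/D² ≤ ‖A‖‖B‖ X_N` (`D = Θ_N + X_W(N) ≥ Θ_N ≥ 1`).

* §1 scalar bookkeeping (pure real inequalities; all variables opaque): `abs_sum_frame_le`, `abs_sum_sum_frame_le`,
  `code_pointwise`, `num_bound`, `W_le`, `code_bookkeeping`.
* §2 `codeTraceCluster_core` (exponent form `a + b + 2w = p + w = N`) and `stub_codeTraceCluster` (the card's statement: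
  `|modelCorr| ≤ (q+1)·‖A‖‖B‖·(six landed terms with SECTOR excesses) + (q+1)²(2+X_p)(‖A‖εc + ‖B‖εc + εc²)`).

[folklore] finite-dimensional linear algebra; nothing here is summit-bearing by itself; not a gap claim.
-/

set_option autoImplicit false

noncomputable section

open scoped BigOperators InnerProductSpace
open InnerProductSpace
open Summit.QuantumFields.YangMills.Theorems.WeakCouplingHypercubicLimit.TraceNormColdPressure
  (stub_traceHolder abs_real_inner_apply_le_opNorm)

namespace Summit.QuantumFields.YangMills.Cruxes.IR.FluxCodeBlindness

namespace CodeTrace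

/-! ## §1 Scalar bookkeeping -/

section Real

variable {q : ℕ} {θ : Fin (q + 1) → ℝ}

/-- A `θ^m`-weighted sum of `q+1` terms bounded by `C` is bounded by `(q+1)·C` (`θ_k ∈ [0,1]`). -/
theorem abs_sum_frame_le (hθ : ∀ k, 0 ≤ θ k ∧ θ k ≤ 1) (m : ℕ) {c : Fin (q + 1) → ℝ} {C : ℝ}
    (hc : ∀ k, |c k| ≤ C) : |∑ k, θ k ^ m * c k| ≤ ((q + 1 : ℕ) : ℝ) * C := by
  calc |∑ k, θ k ^ m * c k| ≤ ∑ k, |θ k ^ m * c k| := Finset.abs_sum_le_sum_abs _ _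
    _ ≤ ∑ _k : Fin (q + 1), C := Finset.sum_le_sum fun k _ => by
        rw [abs_mul, abs_of_nonneg (pow_nonneg (hθ k).1 m)]
        calc θ k ^ m * |c k| ≤ 1 * |c k| := by
              gcongr; exact pow_le_one₀ (hθ k).1 (hθ k).2
          _ ≤ C := by rw [one_mul]; exact hc k
    _ = ((q + 1 : ℕ) : ℝ) * C := by simp [Finset.sum_const, nsmul_eq_mul]

/-- The double-sum version of `abs_sum_frame_le`: bound `(q+1)²·D`. -/
theorem abs_sum_sum_frame_le (hθ : ∀ k, 0 ≤ θ k ∧ θ k ≤ 1) (a b : ℕ) {X : Fin (q + 1) → Fin (q + 1) → ℝ}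
    {D : ℝ} (hX : ∀ k l, |X k l| ≤ D) :
    |∑ k, ∑ l, θ k ^ a * θ l ^ b * X k l| ≤ ((q + 1 : ℕ) : ℝ) ^ 2 * D := by
  have h1 : ∀ k, |∑ l, θ l ^ b * X k l| ≤ ((q + 1 : ℕ) : ℝ) * D :=
    fun k => abs_sum_frame_le hθ b (fun l => hX k l)
  have h2 := abs_sum_frame_le hθ a h1
  have heq : ∑ k, ∑ l, θ k ^ a * θ l ^ b * X k l = ∑ k, θ k ^ a * ∑ l, θ l ^ b * X k l := by
    refine Finset.sum_congr rfl fun k _ => ?_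
    rw [Finset.mul_sum]
    refine Finset.sum_congr rfl fun l _ => ?_
    ring
  rw [heq, sq, mul_assoc]
  exact h2

/-- The code substitution, pointwise. -/
theorem code_pointwise (cA cB mA mB α β εc : ℝ) (hε : 0 ≤ εc) (hA : |cA - mA| ≤ εc)
    (hB : |cB - mB| ≤ εc) (hmA : |mA| ≤ |α|) (hmB : |mB| ≤ |β|) :
    |cA * cB - mA * mB| ≤ |α| * εc + |β| * εc + εc * εc := by
  have e : cA * cB - mA * mB = mB * (cA - mA) + mA * (cB - mB) + (cA - mA) * (cB - mB) := by ring
  rw [e]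
  calc |mB * (cA - mA) + mA * (cB - mB) + (cA - mA) * (cB - mB)|
      ≤ |mB * (cA - mA)| + |mA * (cB - mB)| + |(cA - mA) * (cB - mB)| := abs_add_three _ _ _
    _ = |mB| * |cA - mA| + |mA| * |cB - mB| + |cA - mA| * |cB - mB| := by simp only [abs_mul]
    _ ≤ |β| * εc + |α| * εc + εc * εc := by
        gcongr
    _ = |α| * εc + |β| * εc + εc * εc := by ring

/-- Numerator bound (all variables opaque). -/
theorem num_bound (α β Θ xN Z δu δA δB U DA DB nA nB XN : ℝ)
    (hα : |α| ≤ nA) (hβ : |β| ≤ nB) (hΘ0 : 0 ≤ Θ) (hΘZ : Θ ≤ Z) (hxN0 : 0 ≤ xN) (hxN : xN ≤ XN)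
    (hZ1 : 1 ≤ Z) (hδu : |δu| ≤ U) (hδA : |δA| ≤ DA) (hδB : |δB| ≤ DB) (hU0 : 0 ≤ U) (hDA0 : 0 ≤ DA)
    (hDB0 : 0 ≤ DB) (hnA : 0 ≤ nA) (hnB : 0 ≤ nB) :
    |α * β * Θ * xN + δu * Z - α * Θ * δB - β * Θ * δA - δA * δB| ≤
      Z ^ 2 * (nA * nB * XN + U + nA * DB + nB * DA + DA * DB) := by
  have hZ0 : 0 ≤ Z := by linarith
  have hXN0 : 0 ≤ XN := hxN0.trans hxN
  have t1 : |α * β * Θ * xN| ≤ Z ^ 2 * (nA * nB * XN) := by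
    rw [abs_mul, abs_mul, abs_mul, abs_of_nonneg hΘ0, abs_of_nonneg hxN0]
    have hxZ : xN ≤ Z * XN := by nlinarith
    have h1 : |α| * |β| ≤ nA * nB := mul_le_mul hα hβ (abs_nonneg _) hnA
    have h2 : |α| * |β| * Θ ≤ nA * nB * Z := mul_le_mul h1 hΘZ hΘ0 (by positivity)
    calc |α| * |β| * Θ * xN ≤ nA * nB * Z * (Z * XN) := mul_le_mul h2 hxZ hxN0 (by positivity)
      _ = Z ^ 2 * (nA * nB * XN) := by ring
  have t2 : |δu * Z| ≤ Z ^ 2 * U := by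
    rw [abs_mul, abs_of_nonneg hZ0]
    calc |δu| * Z ≤ U * Z := mul_le_mul_of_nonneg_right hδu hZ0
      _ ≤ U * Z * Z := le_mul_of_one_le_right (by positivity) hZ1
      _ = Z ^ 2 * U := by ring
  have t3 : |α * Θ * δB| ≤ Z ^ 2 * (nA * DB) := by
    rw [abs_mul, abs_mul, abs_of_nonneg hΘ0]
    have h1 : |α| * Θ ≤ nA * Z := mul_le_mul hα hΘZ hΘ0 hnA
    calc |α| * Θ * |δB| ≤ nA * Z * DB := mul_le_mul h1 hδB (abs_nonneg _) (by positivity)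
      _ ≤ nA * Z * DB * Z := le_mul_of_one_le_right (by positivity) hZ1
      _ = Z ^ 2 * (nA * DB) := by ring
  have t4 : |β * Θ * δA| ≤ Z ^ 2 * (nB * DA) := by
    rw [abs_mul, abs_mul, abs_of_nonneg hΘ0]
    have h1 : |β| * Θ ≤ nB * Z := mul_le_mul hβ hΘZ hΘ0 hnB
    calc |β| * Θ * |δA| ≤ nB * Z * DA := mul_le_mul h1 hδA (abs_nonneg _) (by positivity)
      _ ≤ nB * Z * DA * Z := le_mul_of_one_le_right (by positivity) hZ1
      _ = Z ^ 2 * (nB * DA) := by ring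
  have t5 : |δA * δB| ≤ Z ^ 2 * (DA * DB) := by
    rw [abs_mul]
    have hZ2 : 1 ≤ Z ^ 2 := by nlinarith
    calc |δA| * |δB| ≤ DA * DB := mul_le_mul hδA hδB (abs_nonneg _) hDA0
      _ ≤ Z ^ 2 * (DA * DB) := le_mul_of_one_le_left (by positivity) hZ2
  have s1 := abs_sub (α * β * Θ * xN + δu * Z - α * Θ * δB - β * Θ * δA) (δA * δB)
  have s2 := abs_sub (α * β * Θ * xN + δu * Z - α * Θ * δB) (β * Θ * δA)
  have s3 := abs_sub (α * β * Θ * xN + δu * Z) (α * Θ * δB)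
  have s4 := abs_add_le (α * β * Θ * xN) (δu * Z)
  have e : Z ^ 2 * (nA * nB * XN + U + nA * DB + nB * DA + DA * DB) =
      Z ^ 2 * (nA * nB * XN) + Z ^ 2 * U + Z ^ 2 * (nA * DB) + Z ^ 2 * (nB * DA) +
        Z ^ 2 * (DA * DB) := by ring
  rw [e]
  linarith

/-- `W ≤ RHS`: where `q + 1 ≥ 1` is spent. -/
theorem W_le (q1 nA nB εc Xa XN Xp ra rb : ℝ) (hq1 : 1 ≤ q1) (hnA : 0 ≤ nA) (hnB : 0 ≤ nB)
    (hε : 0 ≤ εc) (hXa0 : 0 ≤ Xa) (hXN0 : 0 ≤ XN) (hXp0 : 0 ≤ Xp) (_hra : 0 ≤ ra) (hrb : 0 ≤ rb) :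
    nA * nB * XN +
        (q1 ^ 2 * (nA * εc + nB * εc + εc * εc) + q1 * (nA * rb * nB) + q1 * (nB * ra * nA) +
          Xa * (nA * rb * nB)) +
        nA * (q1 * εc + Xp * nB) + nB * (q1 * εc + Xp * nA) +
        (q1 * εc + Xp * nA) * (q1 * εc + Xp * nB) ≤
      q1 * (nA * nB * (rb * (1 + Xa) + ra + XN + Xp + Xp + Xp * Xp)) +
        q1 ^ 2 * (2 + Xp) * (nA * εc + nB * εc + εc * εc) := by
  have hq1' : 0 ≤ q1 - 1 := by linarith
  have hq2 : 0 ≤ q1 ^ 2 - q1 := by nlinarith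
  have hq0 : 0 ≤ q1 := by linarith
  have hnn : 0 ≤ (q1 - 1) * (nA * nB) * (XN + Xa * rb + 2 * Xp + Xp * Xp) +
      (q1 ^ 2 - q1) * (nA + nB) * εc * (1 + Xp) + q1 ^ 2 * Xp * (εc * εc) := by positivity
  nlinarith [hnn]

/-- The final scalar bookkeeping of the four-term expansion with the code substitution. -/
theorem code_bookkeeping (α β Θ xN LL e1 e2 e3 LA eA LB eB εc Xa XN Xp nA nB ra rb q1 xa xp : ℝ)
    (hΘ : 1 ≤ Θ) (hxN0 : 0 ≤ xN) (hxN : xN ≤ XN) (hxa0 : 0 ≤ xa) (hxa : xa ≤ Xa) (hxp0 : 0 ≤ xp)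
    (hxp : xp ≤ Xp) (hnA : 0 ≤ nA) (hnB : 0 ≤ nB) (hra : 0 ≤ ra) (hrb : 0 ≤ rb) (hq1 : 1 ≤ q1)
    (hε : 0 ≤ εc) (hα : |α| ≤ nA) (hβ : |β| ≤ nB)
    (hLL : |LL - α * β * Θ| ≤ q1 ^ 2 * (nA * εc + nB * εc + εc * εc))
    (he1 : |e1| ≤ q1 * (nA * rb * nB)) (he2 : |e2| ≤ q1 * (nB * ra * nA))
    (he3 : |e3| ≤ xa * (nA * rb * nB))
    (hLA : |LA - α * Θ| ≤ q1 * εc) (heA : |eA| ≤ xp * nA) (hLB : |LB - β * Θ| ≤ q1 * εc)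
    (heB : |eB| ≤ xp * nB) :
    |(LL + e1 + e2 + e3) / (Θ + xN) - (LA + eA) / (Θ + xN) * ((LB + eB) / (Θ + xN))| ≤
      q1 * (nA * nB * (rb * (1 + Xa) + ra + XN + Xp + Xp + Xp * Xp)) +
        q1 ^ 2 * (2 + Xp) * (nA * εc + nB * εc + εc * εc) := by
  have hZ1 : 1 ≤ Θ + xN := by linarith
  have hZ0 : 0 < Θ + xN := by linarith
  have hΘ0 : 0 ≤ Θ := by linarith
  have hΘZ : Θ ≤ Θ + xN := by linarith
  have hXa0 : 0 ≤ Xa := hxa0.trans hxa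
  have hXp0 : 0 ≤ Xp := hxp0.trans hxp
  have hXN0 : 0 ≤ XN := hxN0.trans hxN
  have hq0 : 0 ≤ q1 := by linarith
  -- the three error variables
  have hδu : |LL + e1 + e2 + e3 - α * β * Θ| ≤
      q1 ^ 2 * (nA * εc + nB * εc + εc * εc) + q1 * (nA * rb * nB) + q1 * (nB * ra * nA) +
        Xa * (nA * rb * nB) := by
    have e : LL + e1 + e2 + e3 - α * β * Θ = (LL - α * β * Θ) + e1 + e2 + e3 := by ring
    rw [e]
    have he3' : |e3| ≤ Xa * (nA * rb * nB) :=
      he3.trans (mul_le_mul_of_nonneg_right hxa (by positivity))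
    have s1 := abs_add_le (LL - α * β * Θ + e1 + e2) e3
    have s2 := abs_add_le (LL - α * β * Θ + e1) e2
    have s3 := abs_add_le (LL - α * β * Θ) e1
    linarith
  have hδA : |LA + eA - α * Θ| ≤ q1 * εc + Xp * nA := by
    have e : LA + eA - α * Θ = (LA - α * Θ) + eA := by ring
    rw [e]
    have heA' : |eA| ≤ Xp * nA := heA.trans (mul_le_mul_of_nonneg_right hxp hnA)
    have s1 := abs_add_le (LA - α * Θ) eA
    linarith
  have hδB : |LB + eB - β * Θ| ≤ q1 * εc + Xp * nB := by
    have e : LB + eB - β * Θ = (LB - β * Θ) + eB := by ring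
    rw [e]
    have heB' : |eB| ≤ Xp * nB := heB.trans (mul_le_mul_of_nonneg_right hxp hnB)
    have s1 := abs_add_le (LB - β * Θ) eB
    linarith
  -- the key identity
  have key : (LL + e1 + e2 + e3) / (Θ + xN) - (LA + eA) / (Θ + xN) * ((LB + eB) / (Θ + xN)) =
      (α * β * Θ * xN + (LL + e1 + e2 + e3 - α * β * Θ) * (Θ + xN) -
        α * Θ * (LB + eB - β * Θ) - β * Θ * (LA + eA - α * Θ) -
        (LA + eA - α * Θ) * (LB + eB - β * Θ)) / (Θ + xN) ^ 2 := by
    have hZne : Θ + xN ≠ 0 := ne_of_gt hZ0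
    field_simp
    ring
  have hnum := num_bound α β Θ xN (Θ + xN) (LL + e1 + e2 + e3 - α * β * Θ) (LA + eA - α * Θ)
    (LB + eB - β * Θ) _ _ _ nA nB XN hα hβ hΘ0 hΘZ hxN0 hxN hZ1 hδu hδA hδB (by positivity)
    (by positivity) (by positivity) hnA hnB
  have hW := W_le q1 nA nB εc Xa XN Xp ra rb hq1 hnA hnB hε hXa0 hXN0 hXp0 hra hrb
  have hZ2 : (0 : ℝ) < (Θ + xN) ^ 2 := by positivity
  rw [key, abs_div, abs_of_pos hZ2, div_le_iff₀ hZ2]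
  refine hnum.trans ?_
  rw [mul_comm]
  exact mul_le_mul_of_nonneg_right hW hZ2.le

end Real

/-! ## §2 The core theorem -/

section Main

/-- **Code trace clustering (core form, PROVED).**  Exponents `a + b + 2w = p + w = N`. -/
theorem codeTraceCluster_core (d q : ℕ)
    (T A B : EuclideanSpace ℝ (Fin d) →L[ℝ] EuclideanSpace ℝ (Fin d))
    (e : Fin (q + 1) → EuclideanSpace ℝ (Fin d)) (θ : Fin (q + 1) → ℝ) (ρ εc Xa XN Xp : ℝ)
    (a b p w N : ℕ)
    (hT : T.IsPositive) (hon : Orthonormal ℝ e) (hTe : ∀ k, T (e k) = θ k • e k) (hθ0 : θ 0 = 1)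
    (hθ : ∀ k, 0 ≤ θ k ∧ θ k ≤ 1) (hcon : ∀ v, (∀ k, ⟪e k, v⟫_ℝ = 0) → ‖T v‖ ≤ ρ * ‖v‖)
    (hcA : ∀ k l, |⟪e k, A (e l)⟫_ℝ - (if k = l then ⟪e 0, A (e 0)⟫_ℝ * θ k ^ w else 0)| ≤ εc)
    (hcB : ∀ k l, |⟪e k, B (e l)⟫_ℝ - (if k = l then ⟪e 0, B (e 0)⟫_ℝ * θ k ^ w else 0)| ≤ εc)
    (hρ : 0 ≤ ρ) (hε : 0 ≤ εc) (hN : a + b + 2 * w = N) (hpN : p + w = N)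
    (hXa : tr' (T ^ a) - ∑ k, θ k ^ a ≤ Xa) (hXN : tr' (T ^ N) - ∑ k, θ k ^ N ≤ XN)
    (hXp : tr' (T ^ p) - ∑ k, θ k ^ p ≤ Xp) :
    |tr' (T ^ a * A * T ^ b * B) / tr' (T ^ N) -
        tr' (T ^ p * A) / tr' (T ^ N) * (tr' (T ^ p * B) / tr' (T ^ N))| ≤
      ((q + 1 : ℕ) : ℝ) * (‖A‖ * ‖B‖ * (ρ ^ b * (1 + Xa) + ρ ^ a + XN + Xp + Xp + Xp * Xp)) +
        ((q + 1 : ℕ) : ℝ) ^ 2 * (2 + Xp) * (‖A‖ * εc + ‖B‖ * εc + εc * εc) := by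
  -- the residuals
  have hRpos : ∀ m, (resid T e θ m).IsPositive := fun m => resid_isPositive hon hT hTe hρ hcon m
  have hRn : ∀ m, ‖resid T e θ m‖ ≤ ρ ^ m := fun m => norm_resid_le hon hT hTe hρ hcon m
  have hx : ∀ m, tr' (resid T e θ m) = tr' (T ^ m) - ∑ k, θ k ^ m := fun m => by
    rw [resid, tr'_sub, tr'_framePow hon]
  have hx0 : ∀ m, 0 ≤ tr' (resid T e θ m) := fun m => (hRpos m).toLinearMap.trace_nonneg
  have hdec : ∀ m, T ^ m = framePow e θ m + resid T e θ m := fun m => pow_eq_framePow_add_resid m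
  have hq1 : (1 : ℝ) ≤ ((q + 1 : ℕ) : ℝ) := by exact_mod_cast Nat.succ_le_succ (Nat.zero_le q)
  have hnA := norm_nonneg A
  have hnB := norm_nonneg B
  have hαA : |⟪e 0, A (e 0)⟫_ℝ| ≤ ‖A‖ := abs_real_inner_apply_le_opNorm A (hon.1 0)
  have hβB : |⟪e 0, B (e 0)⟫_ℝ| ≤ ‖B‖ := abs_real_inner_apply_le_opNorm B (hon.1 0)
  -- `Θ ≥ 1`
  have hΘ1 : (1 : ℝ) ≤ ∑ k, θ k ^ N := by
    calc (1 : ℝ) = θ 0 ^ N := by rw [hθ0, one_pow]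
      _ ≤ ∑ k, θ k ^ N :=
          Finset.single_le_sum (f := fun k => θ k ^ N) (fun k _ => pow_nonneg (hθ k).1 N)
            (Finset.mem_univ 0)
  -- the four-term expansion
  have eLL : tr' (T ^ a * A * T ^ b * B) =
      tr' (framePow e θ a * A * framePow e θ b * B) + tr' (framePow e θ a * (A * resid T e θ b * B)) +
        tr' (resid T e θ a * A * (framePow e θ b * B)) + tr' (resid T e θ a * (A * resid T e θ b * B)) := by
    have hexp : T ^ a * A * T ^ b * B =
        framePow e θ a * A * framePow e θ b * B + framePow e θ a * (A * resid T e θ b * B) +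
          resid T e θ a * A * (framePow e θ b * B) + resid T e θ a * (A * resid T e θ b * B) := by
      rw [hdec a, hdec b]; noncomm_ring
    rw [hexp, tr'_add, tr'_add, tr'_add]
  have eA : tr' (T ^ p * A) = tr' (framePow e θ p * A) + tr' (resid T e θ p * A) := by
    rw [hdec p, add_mul, tr'_add]
  have eB : tr' (T ^ p * B) = tr' (framePow e θ p * B) + tr' (resid T e θ p * B) := by
    rw [hdec p, add_mul, tr'_add]
  have eZ : tr' (T ^ N) = (∑ k, θ k ^ N) + tr' (resid T e θ N) := by rw [hx N]; ring
  -- LL: the code substitution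
  have hprod : ∀ k l : Fin (q + 1),
      (if k = l then ⟪e 0, A (e 0)⟫_ℝ * θ k ^ w else 0) * (if l = k then ⟪e 0, B (e 0)⟫_ℝ * θ l ^ w else 0) =
        if k = l then ⟪e 0, A (e 0)⟫_ℝ * θ k ^ w * (⟪e 0, B (e 0)⟫_ℝ * θ l ^ w) else 0 := by
    intro k l
    by_cases h : k = l
    · subst h; simp
    · simp [h]
  have hX : ∀ k l : Fin (q + 1),
      |⟪e k, A (e l)⟫_ℝ * ⟪e l, B (e k)⟫_ℝ -
          (if k = l then ⟪e 0, A (e 0)⟫_ℝ * θ k ^ w * (⟪e 0, B (e 0)⟫_ℝ * θ l ^ w) else 0)| ≤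
        ‖A‖ * εc + ‖B‖ * εc + εc * εc := by
    intro k l
    have hmA : |(if k = l then ⟪e 0, A (e 0)⟫_ℝ * θ k ^ w else 0)| ≤ |⟪e 0, A (e 0)⟫_ℝ| := by
      split_ifs
      · rw [abs_mul, abs_of_nonneg (pow_nonneg (hθ k).1 w)]
        exact mul_le_of_le_one_right (abs_nonneg _) (pow_le_one₀ (hθ k).1 (hθ k).2)
      · simp
    have hmB : |(if l = k then ⟪e 0, B (e 0)⟫_ℝ * θ l ^ w else 0)| ≤ |⟪e 0, B (e 0)⟫_ℝ| := by
      split_ifs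
      · rw [abs_mul, abs_of_nonneg (pow_nonneg (hθ l).1 w)]
        exact mul_le_of_le_one_right (abs_nonneg _) (pow_le_one₀ (hθ l).1 (hθ l).2)
      · simp
    rw [← hprod k l]
    refine (code_pointwise _ _ _ _ _ _ εc hε (hcA k l) (hcB l k) hmA hmB).trans ?_
    have h1 : |⟪e 0, A (e 0)⟫_ℝ| * εc ≤ ‖A‖ * εc := mul_le_mul_of_nonneg_right hαA hε
    have h2 : |⟪e 0, B (e 0)⟫_ℝ| * εc ≤ ‖B‖ * εc := mul_le_mul_of_nonneg_right hβB hε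
    linarith
  have hΘexp : ⟪e 0, A (e 0)⟫_ℝ * ⟪e 0, B (e 0)⟫_ℝ * ∑ k, θ k ^ N =
      ∑ k, ∑ l, θ k ^ a * θ l ^ b *
        (if k = l then ⟪e 0, A (e 0)⟫_ℝ * θ k ^ w * (⟪e 0, B (e 0)⟫_ℝ * θ l ^ w) else 0) := by
    rw [Finset.mul_sum]
    refine Finset.sum_congr rfl fun k _ => ?_
    simp only [mul_ite, mul_zero, Finset.sum_ite_eq, Finset.mem_univ, if_true]
    rw [← hN]; ring
  have hLL : |tr' (framePow e θ a * A * framePow e θ b * B) -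
      ⟪e 0, A (e 0)⟫_ℝ * ⟪e 0, B (e 0)⟫_ℝ * ∑ k, θ k ^ N| ≤
      ((q + 1 : ℕ) : ℝ) ^ 2 * (‖A‖ * εc + ‖B‖ * εc + εc * εc) := by
    rw [tr'_LL, hΘexp, ← Finset.sum_sub_distrib]
    simp_rw [← Finset.sum_sub_distrib, ← mul_sub]
    exact abs_sum_sum_frame_le hθ a b hX
  -- LW, WL, WW
  have hARB : ‖A * resid T e θ b * B‖ ≤ ‖A‖ * ρ ^ b * ‖B‖ := by
    calc ‖A * resid T e θ b * B‖ ≤ ‖A * resid T e θ b‖ * ‖B‖ := norm_mul_le _ _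
      _ ≤ ‖A‖ * ‖resid T e θ b‖ * ‖B‖ := by gcongr; exact norm_mul_le _ _
      _ ≤ ‖A‖ * ρ ^ b * ‖B‖ := by gcongr; exact hRn b
  have hBRA : ‖B * (resid T e θ a * A)‖ ≤ ‖B‖ * ρ ^ a * ‖A‖ := by
    calc ‖B * (resid T e θ a * A)‖ ≤ ‖B‖ * ‖resid T e θ a * A‖ := norm_mul_le _ _
      _ ≤ ‖B‖ * (‖resid T e θ a‖ * ‖A‖) := by gcongr; exact norm_mul_le _ _
      _ ≤ ‖B‖ * (ρ ^ a * ‖A‖) := by gcongr; exact hRn a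
      _ = ‖B‖ * ρ ^ a * ‖A‖ := by ring
  have he1 : |tr' (framePow e θ a * (A * resid T e θ b * B))| ≤ ((q + 1 : ℕ) : ℝ) * (‖A‖ * ρ ^ b * ‖B‖) := by
    rw [tr'_framePow_mul]
    exact abs_sum_frame_le hθ a fun k =>
      (abs_real_inner_apply_le_opNorm _ (hon.1 k)).trans hARB
  have he2 : |tr' (resid T e θ a * A * (framePow e θ b * B))| ≤ ((q + 1 : ℕ) : ℝ) * (‖B‖ * ρ ^ a * ‖A‖) := by
    rw [tr'_comm, mul_assoc, tr'_framePow_mul]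
    exact abs_sum_frame_le hθ b fun k =>
      (abs_real_inner_apply_le_opNorm _ (hon.1 k)).trans hBRA
  have he3 : |tr' (resid T e θ a * (A * resid T e θ b * B))| ≤
      tr' (resid T e θ a) * (‖A‖ * ρ ^ b * ‖B‖) := by
    refine (stub_traceHolder d _ _ (hRpos a)).trans ?_
    exact mul_le_mul_of_nonneg_left hARB (hx0 a)
  -- the one-point traces
  have hΘA : ⟪e 0, A (e 0)⟫_ℝ * ∑ k, θ k ^ N = ∑ k, θ k ^ p * (⟪e 0, A (e 0)⟫_ℝ * θ k ^ w) := by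
    rw [Finset.mul_sum]
    refine Finset.sum_congr rfl fun k _ => ?_
    rw [← hpN]; ring
  have hΘB : ⟪e 0, B (e 0)⟫_ℝ * ∑ k, θ k ^ N = ∑ k, θ k ^ p * (⟪e 0, B (e 0)⟫_ℝ * θ k ^ w) := by
    rw [Finset.mul_sum]
    refine Finset.sum_congr rfl fun k _ => ?_
    rw [← hpN]; ring
  have hLA : |tr' (framePow e θ p * A) - ⟪e 0, A (e 0)⟫_ℝ * ∑ k, θ k ^ N| ≤ ((q + 1 : ℕ) : ℝ) * εc := by
    rw [tr'_framePow_mul, hΘA, ← Finset.sum_sub_distrib]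
    simp_rw [← mul_sub]
    exact abs_sum_frame_le hθ p fun k => by have h := hcA k k; rwa [if_pos rfl] at h
  have hLB : |tr' (framePow e θ p * B) - ⟪e 0, B (e 0)⟫_ℝ * ∑ k, θ k ^ N| ≤ ((q + 1 : ℕ) : ℝ) * εc := by
    rw [tr'_framePow_mul, hΘB, ← Finset.sum_sub_distrib]
    simp_rw [← mul_sub]
    exact abs_sum_frame_le hθ p fun k => by have h := hcB k k; rwa [if_pos rfl] at h
  have heA : |tr' (resid T e θ p * A)| ≤ tr' (resid T e θ p) * ‖A‖ := stub_traceHolder d _ _ (hRpos p)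
  have heB : |tr' (resid T e θ p * B)| ≤ tr' (resid T e θ p) * ‖B‖ := stub_traceHolder d _ _ (hRpos p)
  -- trace-excess hypotheses
  have hxa : tr' (resid T e θ a) ≤ Xa := by rw [hx a]; exact hXa
  have hxN : tr' (resid T e θ N) ≤ XN := by rw [hx N]; exact hXN
  have hxp : tr' (resid T e θ p) ≤ Xp := by rw [hx p]; exact hXp
  -- assemble
  rw [eLL, eA, eB, eZ]
  exact code_bookkeeping (⟪e 0, A (e 0)⟫_ℝ) (⟪e 0, B (e 0)⟫_ℝ) (∑ k, θ k ^ N) (tr' (resid T e θ N))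
    _ _ _ _ _ _ _ _ εc Xa XN Xp ‖A‖ ‖B‖ (ρ ^ a) (ρ ^ b) ((q + 1 : ℕ) : ℝ) (tr' (resid T e θ a))
    (tr' (resid T e θ p)) hΘ1 (hx0 N) hxN (hx0 a) hxa (hx0 p) hxp hnA hnB (pow_nonneg hρ a)
    (pow_nonneg hρ b) hq1 hε hαA hβB hLL he1 he2 he3 hLA heA hLB heB

end Main

end CodeTrace

/-! ## §3 The attack lemma in the card's form -/

/-- **`stub_codeTraceCluster` — `q`-level trace clustering of a light-code model** (the `q`-level twin of the landed
`stub_traceCluster`; the card's attack lemma, name kept for the downstream seams): for a light-code model with contraction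
`ρ ∈ [0,1]`, code error `εc ≥ 0`, `w < n ≤ S`, `2w ≤ S` and sector excesses `≤ Xa, XN, Xp` at the three exponents,
`|modelCorr T A B S n w| ≤ (q+1)‖A‖‖B‖(ρ^{n−w}(1+Xa) + ρ^{2S+1−n−w} + XN + 2Xp + Xp²) + (q+1)²(2+Xp)(‖A‖εc + ‖B‖εc + εc²)`.
[folklore] -/
theorem stub_codeTraceCluster :
    ∀ (d q : ℕ) (T Ao Bo : Euc d →L[ℝ] Euc d) (e : Fin (q + 1) → Euc d) (θ : Fin (q + 1) → ℝ)
      (ρ εc Xa XN Xp : ℝ) (S n w : ℕ),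
      LightCodeModel T Ao Bo e θ ρ εc w → 0 ≤ ρ → ρ ≤ 1 → 0 ≤ εc → w < n → n ≤ S → 2 * w ≤ S →
      secExcess T θ (2 * S + 1 - n - w) ≤ Xa → secExcess T θ (2 * S + 1) ≤ XN → secExcess T θ (2 * S + 1 - w) ≤ Xp →
      |modelCorr T Ao Bo S n w| ≤
        ((q + 1 : ℕ) : ℝ) * (‖Ao‖ * ‖Bo‖ * (ρ ^ (n - w) * (1 + Xa) + ρ ^ (2 * S + 1 - n - w) + XN + Xp + Xp + Xp * Xp)) +
          ((q + 1 : ℕ) : ℝ) ^ 2 * (2 + Xp) * (‖Ao‖ * εc + ‖Bo‖ * εc + εc * εc) := by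
  intro d q T Ao Bo e θ ρ εc Xa XN Xp S n w hM hρ _hρ1 hε hwn hnS _hwS hXa hXN hXp
  obtain ⟨hT, hon, hTe, hθ0, hθ, hcon, hcA, hcB⟩ := hM
  exact CodeTrace.codeTraceCluster_core d q T Ao Bo e θ ρ εc Xa XN Xp (2 * S + 1 - n - w) (n - w)
    (2 * S + 1 - w) w (2 * S + 1) hT hon hTe hθ0 hθ hcon hcA hcB hρ hε (by omega) (by omega) hXa hXN hXp

end Summit.QuantumFields.YangMills.Cruxes.IR.FluxCodeBlindness

end
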